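import Summits.QuantumFields.QCD.Theorems.WilsonMobilityGapMobilityGapSketchDeepWindowComp
import Summits.QuantumFields.QCD.Theorems.WilsonMobilityGapMobilityGapSketchWindowMono
import Summits.QuantumFields.QCD.Theorems.WilsonMobilityGapMobilityGapSketchWindowDOS

/-!
# Crux `MobilityGap` (stmt-QuantumFields-9150) — line `Sketch`, skeleton v6 (FREE DATA; lead c4 reshapes 4–5, cycle 5)

The threshold line run on ARBITRARY admissible data (`…SketchFreeDefs.lean`, `…SketchFreeReduction.lean`, landed):
the infrared stub is `LightMomentFree N_f` — NECESSARY for the crux (`lawLightFree_of_mobilityGap`) and implied by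
the sibling crux `PauliWegnerSea.OneScaleTrajectory` (`lawLightFree_of_oneScaleTrajectory`) — and the remaining
laws are asked along every admissible datum carrying a light moment.

RESHAPE 4 (lead c4, cycle 5; glue landed in `…SketchWindow.lean`): the SIGN side is split by flavour number.  For
`N_f = 2` a negative two-flavour Wilson weight forces a real eigenvalue of `D_W(U,0,1)` STRICTLY BETWEEN the two bare
masses (intermediate value theorem on the real polynomial `t ↦ det D_W(U,t,1)`; the mass-splitting lemma of barrier
`WilsonDeterminantMassSplitting`), so clause (iv) at `N_f = 2` needs only the WINDOW LAW `stub_windowAt` — the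
phase-quenched expected number of real modes in the spread window `(-max t, -min t)` (width `≤ a_k M/Z_m(k)`) is `≤ 1/4`
at the scheme's volume, a Wegner-type statement void on the degenerate diagonal — while `N_f = 3` keeps the
deep-crosser EXTINCTION LAW `stub_extinctAt` (a Lifshitz-tail statement, where the route's `S_disl·b₀ > 1` lives).
RESHAPE 5 (same cycle; glue landed in `…SketchDeepWindow.lean`, `…SketchDeepWindowComp.lean`): for `N_f = 3` a negative weight
forces a real mode either below ALL three bare masses (DEEP) or strictly between two of them (WINDOW), so the three-flavour
sign stub is asked with the refined integrand `#deep + #window` (`stub_deepWindowAt`) instead of `Σ_f #{Re < -t_f}` —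
pointwise smaller (`countP_deep_add_countP_spread_le_sum`); the odd-flavour obstruction (barrier `WilsonDeterminantSign`) is the
`#deep` part, the mass-splitting one (barrier `WilsonDeterminantMassSplitting`) the `#window` part.  Kernel-checked weakenings:
v4 `LawExtinctFree` ⟹ v5 (`windowLaw_of_extinctLaw_two`, p120342) ⟹ v6 (`deepWindowLaw_of_extinctLaw_three`); Hermitian
entrance for `N_f = 2`: `windowLaw_of_windowDOSLaw_two` (p120854, Wegner/DOS form ⟹ `stub_windowAt`).
Four registered stubs; `MobilityGap_of` concludes the crux BY NAME through the landed `MobilityGap_of_freeLaws_deepWindow`.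

NECESSITY ORDER (lead c3, cycle 4; landed `…MobilityGapCriticalMassOrder.lean`, p118462): clause (iii) against the tree's
`ℓ²` Neumann bound at every positive bare mass forces every witness of the crux to have bare masses and `m_crit(k)`
`≤ K a_k` eventually (`mobilityGap_witness_order`), and every light point of `stub_lightFree` may be taken in `(-1, K a_k]`
(`…LightChannelOrder.lean`): all stubs concern the closed supercritical region `κ ≥ 1/8 − O(a_k)` of the interacting
Wilson measure, where no background-uniform resolvent bound exists.
-/

noncomputable section

namespace Summit.QuantumFields.QCD.Theorems.MobilityGapSketch

open scoped BigOperators Topology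
open MeasureTheory Filter Set
open Literature.MathematicalPhysics.QuantumFieldTheory Literature.MathematicalPhysics.QuantumLattice
  Literature.Probability.LatticeModels

/-- `stub_lightFree` — INFRARED, FREE CURRENCY (= `LawLightFree` unfolded to `LightMomentFree`/`LightMomentAt`):
for `N_f ∈ {2,3}` there are admissible data — spacings `a_k > 0`, `a_k → 0`, inverse couplings `β_k` with
`β_k - afBeta N_f Λ a_k → 0` for some `Λ > 0` — an exponent `s ∈ (0,1)` and a physical rate `r` such that,
eventually in `k`, at SOME bare mass `x > -1` (degenerate tuple) some flavour's phase-quenched `s`-moment of the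
propagator entry sum obeys `c · e^{-r a_k n} ≤ E_{|w|,β_k,S,x}[(Σ|G_f(0, n e₀)|)^s]` for all tori `S ≥ S₀` and all
`n ≤ S` (`c > 0`, `S₀` may depend on `k`).  NECESSARY for the crux (clauses (i)+(iii) of any witness at `m ≡ 1`:
landed `lightMomentFree_of_mobilityGap`), and a consequence of `PauliWegnerSea.OneScaleTrajectory` (stmt-11513).
Physically: along some asymptotically free sequence of couplings the Wilson bare axis above `-1` carries an
`a_k`-light channel (the chiral critical point of the interacting phase-quenched measure). Open-problem class. -/
theorem stub_lightFree :
    ∀ Nf : ℕ, Nf = 2 ∨ Nf = 3 → ∃ a β : ℕ → ℝ, (∀ k, 0 < a k) ∧ Tendsto a atTop (𝓝 0) ∧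
      (∃ Λ > (0 : ℝ), Tendsto (fun k => β k - afBeta Nf Λ (a k)) atTop (𝓝 0)) ∧
        ∃ s : ℝ, 0 < s ∧ s < 1 ∧ ∃ r : ℝ, ∀ᶠ k in atTop, ∃ x : ℝ, -1 < x ∧ ∃ (f : Fin Nf) (c : ℝ), 0 < c ∧
          ∃ S₀ : ℕ, ∀ S : ℕ, S₀ ≤ S → ∀ n : ℕ, n ≤ S →
            c * Real.exp (-(r * (a k * n))) ≤ fm Nf (β k) (fun _ => x) S f (Pi.single 0 (n : ℤ)) s := by
  sorry

/-- `stub_lowerAt` — CLAUSE (iii) IN THE RENORMALISED WINDOW ABOVE THE THRESHOLD, ALONG EVERY LIGHT DATUM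
(= `LawLowerFree`): for `N_f ∈ {2,3}` and every admissible datum `d` carrying a light `d.s`-moment, for every large
`δ` and every `M > 0` there are `s ∈ (0,1)`, `c₀ > 0`, `C₁`, `p` such that eventually in `k`: if the floor set is
non-empty and `-1 < m_crit(k) = thrD d δ k`, every bare tuple `t ∈ (m_crit(k), m_crit(k) + a_k M/Z_m(k)]^{N_f}` obeys
`c₀ e^{-C₁ a_k n}(n+1)^{-p} ≤ fm(β_k, t, S, f, n e₀, s)` on all tori `S ≥ L⁰_k`, all `f`, all `n ≤ S`.  Content: no
jump of the physical rate across the decay threshold, `k`-uniform UV corner, volume/direction transport — for the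
interacting phase-quenched Wilson measure. Open-problem class. -/
theorem stub_lowerAt :
    ∀ Nf : ℕ, Nf = 2 ∨ Nf = 3 → ∀ d : LineData Nf, LightMomentAt Nf d.a d.β d.s →
      ∀ᶠ δ in atTop, ∀ M : ℝ, 0 < M → ∃ s c₀ C₁ p : ℝ, 0 < s ∧ s < 1 ∧ 0 < c₀ ∧ ∀ᶠ k in atTop,
        (floorSetD d δ k).Nonempty → -1 < thrD d δ k → ∀ t : Fin Nf → ℝ,
          (∀ f, thrD d δ k < t f) → (∀ f, t f ≤ thrD d δ k + d.a k * M / d.zm k) →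
            ∀ S : ℕ, d.vfloor k ≤ S → ∀ (f : Fin Nf) (n : ℕ), n ≤ S →
              c₀ * Real.exp (-(C₁ * (d.a k * n) + p * Real.log (n + 1))) ≤
                fm Nf (d.β k) t S f (Pi.single 0 (n : ℤ)) s := by
  sorry

/-- `stub_windowAt` — TWO FLAVOURS: REAL MODES IN THE MASS-SPLITTING WINDOW ARE RARE AT THE SCHEME'S OWN VOLUME,
ALONG EVERY LIGHT DATUM (reshape 4).  For every admissible two-flavour datum `d` carrying a light `d.s`-moment there
is an admissible volume sequence `L ≥ L⁰` (eventually) such that for every large `δ`, every `M > 0`, eventually in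
`k`: if the floor set is non-empty and `-1 < m_crit(k)`, then for every window pair `t ∈ (m_crit(k), m_crit(k) + a_k M/Z_m(k)]²`
the phase-quenched (weight `|det D_W(t₀)|·|det D_W(t₁)|`) expected number of real eigenvalues of `D_W(U,0,1)` in the
open spread window `(-max(t₀,t₁), -min(t₀,t₁))` on the torus of side `2L_k+1` at coupling `β_k` is `≤ 1/4`.  Glued to
clause (iv) at `N_f = 2` by the landed `signAt_of_windowAt` (`(1-⟨sign⟩₊)/2 ≤ E₊[#window]`, IVT between the masses).
The count vanishes identically on the degenerate diagonal `t₀ = t₁`; the window has bare width `≤ a_k M/Z_m(k)`, so the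
content is a WEGNER-type estimate (density of real modes of the massless Wilson operator just below `|m_crit(k)|`,
times window, times `(2L_k+1)⁴`) for the interacting phase-quenched measure — strictly less than extinction of all deep
crossers.  Open-problem class (no Wegner estimate for non-abelian link disorder is in print: route why-might-fail). -/
theorem stub_windowAt :
    ∀ d : LineData 2, LightMomentAt 2 d.a d.β d.s →
      ∃ L : ℕ → ℕ, Tendsto (fun k => d.a k * (L k : ℝ)) atTop atTop ∧ (∀ᶠ k in atTop, d.vfloor k ≤ L k) ∧
        ∀ᶠ δ in atTop, ∀ M : ℝ, 0 < M → ∀ᶠ k in atTop,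
          (floorSetD d δ k).Nonempty → -1 < thrD d δ k → ∀ t : Fin 2 → ℝ,
            (∀ f, thrD d δ k < t f) → (∀ f, t f ≤ thrD d δ k + d.a k * M / d.zm k) →
              (∫ U : GaugeConfig 4 (2 * L k + 1) (Matrix.specialUnitaryGroup (Fin 3) ℂ),
                  ((wilsonDirac (fundamentalRep (Fin 3)) U 0 1).charpoly.roots.countP
                      (fun z : ℂ => z.im = 0 ∧ -max (t 0) (t 1) < z.re ∧ z.re < -min (t 0) (t 1)) : ℝ) *
                    ∏ f : Fin 2, ‖fermionDet (wilsonDirac (fundamentalRep (Fin 3)) U (t f) 1)‖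
                  ∂(wilsonMeasure (d := 4) (L := 2 * L k + 1) (fundamentalRep (Fin 3)) (d.β k))) /
                (∫ U : GaugeConfig 4 (2 * L k + 1) (Matrix.specialUnitaryGroup (Fin 3) ℂ),
                  ∏ f : Fin 2, ‖fermionDet (wilsonDirac (fundamentalRep (Fin 3)) U (t f) 1)‖
                  ∂(wilsonMeasure (d := 4) (L := 2 * L k + 1) (fundamentalRep (Fin 3)) (d.β k))) ≤ 1 / 4 := by
  sorry

/-- `stub_deepWindowAt` — THREE FLAVOURS: DEEP CROSSERS AND WINDOW MODES ARE RARE AT THE SCHEME'S OWN VOLUME, ALONG EVERY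
LIGHT DATUM (reshape 5; = v5's `stub_extinctAt` with the refined count).  For every admissible three-flavour datum `d` carrying
a light `d.s`-moment there is an admissible volume sequence `L ≥ L⁰` (eventually) such that for every large `δ`, every `M > 0`,
eventually in `k`: if the floor set is non-empty and `-1 < m_crit(k)`, then for every window triple
`t ∈ (m_crit(k), m_crit(k) + a_k M/Z_m(k)]³` the phase-quenched (weight `Π_f |det D_W(t_f)|`) expected number of real eigenvalues
`z` of `D_W(U,0,1)` that are either DEEP (`Re z < -t_f` for all `f`: below every bare mass of the triple) or in the spread WINDOW
(`Re z < -t_f` for some `f` and `-t_g < Re z` for some `g`: strictly between two bare masses) on the torus of side `2L_k+1` at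
coupling `β_k` is `≤ 1/4`.  Glued to clause (iv) at `N_f = 3` by the landed `signAt_of_deepWindowAt`
(`(1-⟨sign⟩₊)/2 ≤ E₊[#deep + #window]`, `sign_of_deepWindow_three`).  Content only while `m_crit(k) < 0` (real spectrum of
`D_W(U,0,1)` lies in `[0,8]`).  The `#deep` part is the route's Lifshitz-tail / dislocation statement (`S_disl·b₀ > 1`); the
`#window` part is the `N_f = 3` copy of `stub_windowAt`.  Open-problem class. -/
theorem stub_deepWindowAt :
    ∀ d : LineData 3, LightMomentAt 3 d.a d.β d.s →
      ∃ L : ℕ → ℕ, Tendsto (fun k => d.a k * (L k : ℝ)) atTop atTop ∧ (∀ᶠ k in atTop, d.vfloor k ≤ L k) ∧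
        ∀ᶠ δ in atTop, ∀ M : ℝ, 0 < M → ∀ᶠ k in atTop,
          (floorSetD d δ k).Nonempty → -1 < thrD d δ k → ∀ t : Fin 3 → ℝ,
            (∀ f, thrD d δ k < t f) → (∀ f, t f ≤ thrD d δ k + d.a k * M / d.zm k) →
              (∫ U : GaugeConfig 4 (2 * L k + 1) (Matrix.specialUnitaryGroup (Fin 3) ℂ),
                  (((wilsonDirac (fundamentalRep (Fin 3)) U 0 1).charpoly.roots.countP
                      (fun z : ℂ => z.im = 0 ∧ ∀ f, z.re < -t f) : ℝ) +
                    ((wilsonDirac (fundamentalRep (Fin 3)) U 0 1).charpoly.roots.countP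
                      (fun z : ℂ => z.im = 0 ∧ (∃ f, z.re < -t f) ∧ ∃ g, -t g < z.re) : ℝ)) *
                    ∏ f : Fin 3, ‖fermionDet (wilsonDirac (fundamentalRep (Fin 3)) U (t f) 1)‖
                  ∂(wilsonMeasure (d := 4) (L := 2 * L k + 1) (fundamentalRep (Fin 3)) (d.β k))) /
                (∫ U : GaugeConfig 4 (2 * L k + 1) (Matrix.specialUnitaryGroup (Fin 3) ℂ),
                  ∏ f : Fin 3, ‖fermionDet (wilsonDirac (fundamentalRep (Fin 3)) U (t f) 1)‖
                  ∂(wilsonMeasure (d := 4) (L := 2 * L k + 1) (fundamentalRep (Fin 3)) (d.β k))) ≤ 1 / 4 := by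
  sorry

/-- **Deciding theorem of the reshaped line**: the crux `MobilityGap` BY NAME from the four free stubs, through the
landed `MobilityGap_of_freeLaws_deepWindow : LawLightFree → LawLowerFree → (window law, N_f = 2) → (deep + window law,
N_f = 3) → MobilityGap` (the stub statements are these laws unfolded, so the application is definitional). -/
theorem MobilityGap_of : Summit.QuantumFields.QCD.Theses.WilsonMobilityGap.MobilityGap :=
  MobilityGap_of_freeLaws_deepWindow stub_lightFree stub_lowerAt stub_windowAt stub_deepWindowAt

/-- The v5 form of the three-flavour sign stub still closes the line: `stub_extinctAt`-shaped input (flavour-summed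
deep-crosser count) implies `stub_deepWindowAt` (landed `deepWindowLaw_of_extinctLaw_three`); likewise v4's two-flavour
extinction law implies `stub_windowAt` (`windowLaw_of_extinctLaw_two`) and the Wegner/DOS form implies it
(`windowLaw_of_windowDOSLaw_two`) — recorded here so that a proof of ANY of the stronger forms is accepted as closing the
corresponding stub of this skeleton. -/
theorem entrances_of_stronger_forms :
    ((∀ d : LineData 3, LightMomentAt 3 d.a d.β d.s → ExtinctAt d) →
      ∀ d : LineData 3, LightMomentAt 3 d.a d.β d.s → SignAt d) ∧
    ((∀ d : LineData 2, LightMomentAt 2 d.a d.β d.s → ExtinctAt d) →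
      ∀ d : LineData 2, LightMomentAt 2 d.a d.β d.s → SignAt d) :=
  ⟨fun h d hd => signAt_of_deepWindowAt (deepWindowLaw_of_extinctLaw_three h d hd),
   fun h d hd => signAt_of_windowAt (windowLaw_of_extinctLaw_two h d hd)⟩

end Summit.QuantumFields.QCD.Theorems.MobilityGapSketch

end
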